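import Literature.Probability.LatticeModels.PlaneRotatorMeanFieldBound
import Literature.Probability.LatticeModels.RotatorGriffithsFirst
import HarnessLib

/-!
# The Lieb–Rivasseau separating inequality for plane rotators (named fact)

Topic `Literature/Probability/LatticeModels`. E. H. Lieb, *A refinement of Simon's correlation
inequality*, Comm. Math. Phys. **77** (1980) 127–135 [Lieb1980], eq. (23), proved there for star-shaped
inside systems (p. 132–133) and in general by V. Rivasseau, *Lieb's correlation inequality for plane
rotors*, Comm. Math. Phys. **77** (1980) 145–147 [Rivasseau1980] (Lieb, notes added in proof (2):
"inequality (23) for rotors holds for all subsystems A, not merely for the case of the star graph proved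
here").

Setting (Lieb 1980, p. 128–129 of the reprint, eqs. (4)–(5)): the system `A + C` is the union of two
subsystems of spins `A` and `C` with `A ∩ C = B`, and "the `B` spins separate `A` from `C`" means
`H_{A+C} = H_A + H_C`; for plane rotors the interactions are pairwise ferromagnetic,
`−J_{ab} σ⃗_a · σ⃗_b = −J_{ab} cos(θ_a − θ_b)`, `J_{ab} ≥ 0` (p. 132). Inequality (23): for single spins
`a ∈ A`, `c ∈ C`,

  `⟨σ⃗_a · σ⃗_c⟩_{A+C} ≤ ∑_{b ∈ B} ⟨σ⃗_a · σ⃗_b⟩_A ⟨σ⃗_b · σ⃗_c⟩_{A+C}`.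

Typed here in the tree's finite-volume plane-rotator vocabulary (`PlaneRotator.twoPoint J a b =
⟨cos(θ_a − θ_b)⟩_{V,J}`, couplings `J : V × V → ℝ` on ordered pairs, Gibbs weight
`exp(∑_{(x,y)} J(x,y) cos(θ_y − θ_x))`, inverse temperature absorbed; `PlaneRotatorGinibreComparison.lean`):
the decomposition `H_{A+C} = H_A + H_C` is a pair of non-negative coupling arrays `J_A`, `J_C` supported
on `A × A` and `C × C`, the full system has couplings `J_A + J_C`, and `⟨·⟩_A` is the state of the
couplings `J_A` alone (on the same vertex set — spins outside `A` are then free and integrate out,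
`PlaneRotator.twoPoint_extend_eq`).

STATUS: NAMED FACT (D-0014), not proved here (the proof is Lieb's gluing Lemma 1 with Newman's Gaussian
inequalities and Rivasseau's directed-graph lemma). Consequences in print: Lieb's Theorem 4 (Bessel
criterion `I₁(β)/I₀(β) < 1/2ν ⇒` exponential decay, `β_c ≥ 0.52` in `d = 2`) and "a finite algorithm to
compute the transition temperature" (with Simon 1980, Thm. 1.3). Use: cell `pub/hubbard-tc`, inventory
row B7 / lit THEOREMS-tc T6 (the `K5-Lieb` column `4u(J∥/T) + 2u(J⊥/T) = 1`).

References: [Lieb1980] eq. (23), Theorem 4, notes added in proof; [Rivasseau1980] Theorem (p. 145);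
B. Simon, CMP 77 (1980) 111, Thm. 1.3 [Simon1980CMP].
-/

noncomputable section

open MeasureTheory Finset
open scoped BigOperators

namespace Literature.Probability.LatticeModels

namespace PlaneRotator

/-- **Lieb–Rivasseau separating inequality for plane rotators** (Lieb 1980, eq. (23); Rivasseau 1980,
Theorem): for every finite vertex set `V`, sets of spins `A, C ⊆ V` with `B = A ∩ C`, non-negative pair
couplings `J_A` supported on `A × A` and `J_C` supported on `C × C` (so that `H_{A+C} = H_A + H_C`:
the `B` spins separate `A` from `C`), and single spins `a ∈ A`, `c ∈ C`:

  `⟨cos(θ_a − θ_c)⟩_{J_A + J_C} ≤ ∑_{b ∈ A ∩ C} ⟨cos(θ_a − θ_b)⟩_{J_A} · ⟨cos(θ_b − θ_c)⟩_{J_A + J_C}`.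

Named fact (not proved in the tree). [cite: Lieb1980, eq. (23) and notes added in proof (2)] -/
def LiebRivasseauInequality : Prop :=
  ∀ (V : Type) [Fintype V] [DecidableEq V] [MeasurableSpace Circle] [BorelSpace Circle]
    (A C : Finset V) (JA JC : V × V → ℝ),
    (∀ p, 0 ≤ JA p) → (∀ p, 0 ≤ JC p) →
    (∀ p, JA p ≠ 0 → p.1 ∈ A ∧ p.2 ∈ A) → (∀ p, JC p ≠ 0 → p.1 ∈ C ∧ p.2 ∈ C) →
    ∀ a ∈ A, ∀ c ∈ C,
      twoPoint (JA + JC) a c ≤ ∑ b ∈ A ∩ C, twoPoint JA a b * twoPoint (JA + JC) b c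

/-! ### Consequence: Lieb's decay criterion with star-shaped inside systems (Theorem 4 type) -/

section Star

variable {V : Type} [Fintype V] [DecidableEq V] [MeasurableSpace Circle] [BorelSpace Circle]

/-- The couplings of the STAR of `x`: the pairs having `x` as an endpoint (Lieb 1980, p. 133: "Suppose
`σ⃗_a` is connected to `n` nearest neighbors, which we take to be `B`. It is immaterial whether the `B` spins
are connected together, for any such interaction can be regarded as part of `H_C`"). [cite: Lieb1980, proof of Theorem 4 (star graph)] -/
def starCoupling (J : V × V → ℝ) (x : V) : V × V → ℝ :=
  fun p => if p.1 = x ∨ p.2 = x then J p else 0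

omit [Fintype V] [MeasurableSpace Circle] [BorelSpace Circle] in
/-- The star couplings are non-negative when `J` is. [folklore] -/
private theorem starCoupling_nonneg {J : V × V → ℝ} (hJ : ∀ p, 0 ≤ J p) (x : V) (p : V × V) :
    0 ≤ starCoupling J x p := by
  unfold starCoupling; split_ifs <;> [exact hJ p; exact le_rfl]

/-- An ISOLATED spin is uncorrelated: if `y ≠ x` carries no coupling at all, `⟨cos(θ_x − θ_y)⟩_J = 0`
(flip `θ_y ↦ −θ_y`: the weight is invariant, the observable changes sign). [folklore] -/
private theorem twoPoint_eq_zero_of_isolated {J : V × V → ℝ} {x y : V} (hxy : x ≠ y)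
    (hy : ∀ z, J (y, z) = 0 ∧ J (z, y) = 0) : twoPoint J x y = 0 := by
  set φ : V → Circle := (Pi.mulSingle y (-1 : Circle))⁻¹ with hφ
  -- the Hamiltonian is invariant under flipping the isolated spin
  have hH : ∀ θ : V → Circle, ginibreHamiltonian (pairChars V) J (θ * φ) = ginibreHamiltonian (pairChars V) J θ := by
    intro θ
    unfold ginibreHamiltonian
    refine Finset.sum_congr rfl fun p _ => ?_
    by_cases h1 : p.1 = y
    · rw [show p = (y, p.2) from Prod.ext h1 rfl, (hy p.2).1, zero_mul, zero_mul]
    by_cases h2 : p.2 = y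
    · rw [show p = (p.1, y) from Prod.ext rfl h2, (hy p.1).2, zero_mul, zero_mul]
    congr 1
    simp [reChar, pairChars_apply, hφ, h1, h2]
  have hW : ∀ θ : V → Circle, ginibreWeight (pairChars V) J (θ * φ) = ginibreWeight (pairChars V) J θ := fun θ => by
    rw [ginibreWeight, ginibreWeight, hH]
  have hnum : ∫ θ, cosDiff x y θ * ginibreWeight (pairChars V) J θ ∂torusHaar V =
      -∫ θ, cosDiff x y θ * ginibreWeight (pairChars V) J θ ∂torusHaar V := by
    have h := integral_torusHaar_mul_right (fun θ => cosDiff x y θ * ginibreWeight (pairChars V) J θ) φ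
    simp_rw [hW] at h
    simp only [hφ, cosDiff_mul_inv_mulSingle_neg_one hxy, neg_mul, integral_neg] at h
    exact h.symm
  have h0 : ∫ θ, cosDiff x y θ * ginibreWeight (pairChars V) J θ ∂torusHaar V = 0 := by linarith
  rw [twoPoint, ginibreExpect, h0, zero_div]

/-- In the star system of `x`, a site `y ≠ x` not coupled to `x` is uncorrelated with `x`. [folklore] -/
private theorem twoPoint_starCoupling_eq_zero {J : V × V → ℝ} {x y : V} (hxy : x ≠ y)
    (hJ : J (x, y) = 0 ∧ J (y, x) = 0) : twoPoint (starCoupling J x) x y = 0 := by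
  refine twoPoint_eq_zero_of_isolated hxy fun z => ⟨?_, ?_⟩
  · unfold starCoupling
    by_cases hz : z = x
    · subst hz; simp [hxy.symm, hJ.2]
    · simp [hxy.symm, hz]
  · unfold starCoupling
    by_cases hz : z = x
    · subst hz; simp [hJ.1]
    · simp [hxy.symm, hz]

/-- **Lieb's inequality with the star of `x` as inside system** (Lieb 1980, (23) in the case proved
there, p. 133): for `J ≥ 0` and `c ≠ x`,
`⟨cos(θ_x − θ_c)⟩_J ≤ ∑_{b ≠ x} ⟨cos(θ_x − θ_b)⟩_{star(x)} ⟨cos(θ_b − θ_c)⟩_J` — CONDITIONAL on the named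
fact `LiebRivasseauInequality` (of which this is the instance `A = V`, `C = V ∖ {x}`, `H_A` = the bonds at `x`).
[cite: Lieb1980, eq. (23) for the star graph (proof of Theorem 4)] -/
theorem twoPoint_le_sum_star (h : LiebRivasseauInequality) {J : V × V → ℝ} (hJ : ∀ p, 0 ≤ J p)
    {x c : V} (hxc : x ≠ c) :
    twoPoint J x c ≤ ∑ b ∈ Finset.univ.erase x, twoPoint (starCoupling J x) x b * twoPoint J b c := by
  classical
  set JC : V × V → ℝ := fun p => if p.1 = x ∨ p.2 = x then 0 else J p with hJC
  have hsum : starCoupling J x + JC = J := by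
    funext p
    simp only [Pi.add_apply, starCoupling, hJC]
    split_ifs <;> simp
  have hA : ∀ p, starCoupling J x p ≠ 0 → p.1 ∈ (Finset.univ : Finset V) ∧ p.2 ∈ (Finset.univ : Finset V) :=
    fun p _ => ⟨Finset.mem_univ _, Finset.mem_univ _⟩
  have hC : ∀ p, JC p ≠ 0 → p.1 ∈ Finset.univ.erase x ∧ p.2 ∈ Finset.univ.erase x := by
    intro p hp
    simp only [hJC] at hp
    split_ifs at hp with hpx
    · exact absurd rfl hp
    · push Not at hpx
      exact ⟨Finset.mem_erase.2 ⟨hpx.1, Finset.mem_univ _⟩, Finset.mem_erase.2 ⟨hpx.2, Finset.mem_univ _⟩⟩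
  have hJC0 : ∀ p, 0 ≤ JC p := fun p => by simp only [hJC]; split_ifs <;> [exact le_rfl; exact hJ p]
  have key := h V Finset.univ (Finset.univ.erase x) (starCoupling J x) JC (starCoupling_nonneg hJ x) hJC0 hA hC
    x (Finset.mem_univ x) c (Finset.mem_erase.2 ⟨hxc.symm, Finset.mem_univ c⟩)
  rwa [hsum, Finset.univ_inter] at key

/-- **Lieb's decay criterion (Theorem 4 type), finite-volume form, CONDITIONAL on `LiebRivasseauInequality`.**
Let `J ≥ 0` and suppose every star row sum is at most `A₀`:
`∑_{b ≠ x} ⟨cos(θ_x − θ_b)⟩_{star(x)} ≤ A₀` for all `x` (for the nearest-neighbour model on `ℤ^ν` with coupling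
`β` each term is the two-spin value `I₁(β)/I₀(β)`, so `A₀ = 2ν I₁(β)/I₀(β)` — Lieb's Theorem 4; anisotropic
couplings give `∑_b I₁(βJ_b)/I₀(βJ_b)`). If `d : V → ℕ` vanishes at `c` and is `1`-Lipschitz along the coupled
pairs, then `⟨cos(θ_a − θ_c)⟩_J ≤ A₀^{d a}` for every `a`, the same bound in every volume: exponential decay as
soon as `A₀ < 1` (Simon 1980 Thm 1.3 / the tree's `PlaneRotator.decay_of_subharmonic`).
[cite: Lieb1980, Theorem 4 (with Simon 1980 Thm 1.3)] -/
theorem twoPoint_le_pow_of_star_rowSum_le (h : LiebRivasseauInequality) {J : V × V → ℝ} (hJ : ∀ p, 0 ≤ J p)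
    {A₀ : ℝ} (hrow : ∀ x, ∑ b ∈ Finset.univ.erase x, twoPoint (starCoupling J x) x b ≤ A₀) (c : V) {d : V → ℕ}
    (hd0 : d c = 0) (hd : ∀ x y, x ≠ y → (J (x, y) ≠ 0 ∨ J (y, x) ≠ 0) → d x ≤ d y + 1) (a : V) :
    twoPoint J a c ≤ A₀ ^ d a := by
  classical
  set K : V → V → ℝ := fun x y => if y = x then 0 else 2 * twoPoint (starCoupling J x) x y with hK
  have hK0 : ∀ x y, 0 ≤ K x y := by
    intro x y
    simp only [hK]
    split_ifs
    · exact le_rfl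
    · exact mul_nonneg zero_le_two (twoPoint_nonneg (starCoupling_nonneg hJ x) x y)
  have hKrow : ∀ x, ∑ y, K x y ≤ 2 * A₀ := by
    intro x
    have : ∑ y, K x y = 2 * ∑ b ∈ Finset.univ.erase x, twoPoint (starCoupling J x) x b := by
      rw [Finset.mul_sum, ← Finset.sum_erase_add _ _ (Finset.mem_univ x)]
      simp only [hK, if_true, add_zero]
      refine Finset.sum_congr rfl fun y hy => ?_
      rw [if_neg (Finset.ne_of_mem_erase hy)]
    rw [this]
    exact mul_le_mul_of_nonneg_left (hrow x) zero_le_two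
  have hsub : ∀ x, x ≠ c → twoPoint J x c ≤ (1 / 2) * ∑ y, K x y * twoPoint J y c := by
    intro x hxc
    refine (twoPoint_le_sum_star h hJ hxc).trans (le_of_eq ?_)
    rw [Finset.mul_sum, ← Finset.sum_erase_add _ _ (Finset.mem_univ x)]
    simp only [hK, if_true, zero_mul, mul_zero, add_zero]
    refine Finset.sum_congr rfl fun y hy => ?_
    rw [if_neg (Finset.ne_of_mem_erase hy)]
    ring
  have hdK : ∀ x y, K x y ≠ 0 → d x ≤ d y + 1 := by
    intro x y hxy
    simp only [hK] at hxy
    split_ifs at hxy with hyx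
    · exact absurd rfl hxy
    · refine hd x y (Ne.symm hyx) ?_
      by_contra hzero
      push Not at hzero
      exact hxy (by rw [twoPoint_starCoupling_eq_zero (Ne.symm hyx) hzero, mul_zero])
  have := decay_of_subharmonic (G := fun y => twoPoint J y c) (K := K) (𝒥 := 2 * A₀)
    (fun x => twoPoint_le_one J x c) hK0 hKrow hsub hd0 hdK a
  simpa using this

end Star

end PlaneRotator

end Literature.Probability.LatticeModels
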